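import Literature.NumberTheory.EllipticCurves.CasselsTateParity
import Literature.NumberTheory.EllipticCurves.BSDShaProofs
import HarnessLib

/-!
# `Ш(E/K)[p^∞]` modulo its divisible part is finite of square order (granting Cassels–Tate)

Topic `Literature/NumberTheory/EllipticCurves`, family `bsd`. Theorems only (D-0026: no new named
fact); the Cassels–Tate pairing enters as the explicit hypothesis
`(hCT : WeierstrassCurve.exists_casselsTate_pairing)` (bsd.S18: an alternating bi-additive pairing
`Ш(E/K) × Ш(E/K) → ℚ/ℤ` whose kernel is the subgroup of divisible elements; Cassels 1962, Tate 1962,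
Milne *ADT* I.6.13(a)).

This is the sentence of Dokchitser–Dokchitser, *On the Birch–Swinnerton-Dyer quotients modulo
squares*, Ann. of Math. 172 (2010), proof of Cor. 4.5 (p. 584 = p. 18 of the paper): "the
`p`-primary parts of `Ш/Ш_div` have square order by Cassels–Tate pairing", for elliptic curves over
number fields (there `X₀(X/K)` denotes "`Ш(X/K)` modulo its divisible part", Thm. 4.3), i.e. the
input of their Selmer-group version of the isogeny invariance of the BSD quotient (Thm. 4.3,
Cor. 4.5) that comes from the pairing. We prove it in the form: for `A = Ш(E/K)[p^∞]`,

* `finite_quot_divisibleElements_primaryComponent_sha`,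
  `isSquare_natCard_quot_divisibleElements_primaryComponent_sha`: **`A / A_div` is finite of square
  order**, where `A_div = AddSubgroup.divisibleElements A` (for this group the set of divisible
  elements *is* the maximal divisible subgroup: `divisibleElements_primaryComponent_sha_divisible`);
* `divisibleElements_sha_divisible`: **`Ш_div`, the divisible elements of `Ш(E/K)`, form a divisible
  subgroup** (no pairing needed: `Ш` is torsion with finite `q`-torsion for every prime `q`), so it is
  "the divisible part of `Ш`" of Def. 4.1 / Thm. 4.3 of the paper;
* `finite_primaryComponent_sha_quot_divisibleElements`,
  `isSquare_natCard_primaryComponent_sha_quot_divisibleElements`: **`X₀(E/K)[p^∞] = (Ш/Ш_div)[p^∞]` is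
  finite of square order** — the verbatim form, via
  `nonempty_primaryComponent_sha_quot_divisibleElements_addEquiv : (Ш/Ш_div)[p^∞] ≃+ A / A_div`.

The group theory is separated from the arithmetic, extending the tree's `CasselsTateParity`
(which proves the weaker parity statement `#(A/pA) = p^{2k}` by the same route):

* `exists_nsmul_nsmul_eq_of_not_dvd`: in a `p`-primary group, `x` is an `m`-th multiple of a multiple
  of itself for `p ∤ m`.
* `range_nsmul_pow_eq_divisibleElements_of_stable`: if `A` is `p`-primary and the chain
  `A[p] ∩ p^k A` is stable from `k₀` on, then `C = p^{k₀} A` is a divisible subgroup and equals the set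
  of divisible elements of `A`.
* `finite_quot_and_isSquare_natCard_of_pairing` (**core**): a `p`-primary `A` with finite `A[p]` and an
  alternating pairing `B : A × A → ℚ/ℤ` whose left kernel lies in `⋂_k p^k A` has `A / A_div` finite
  of square order — `B` descends to a nondegenerate alternating pairing on the finite group
  `A / p^{k₀} A` (as in `exists_natCard_modN_eq_pow_two_mul_of_pairing`), which therefore has square
  order (`isSquare_natCard_of_alternating_addCircle`, Silverman Ex. 10.20, file `BSDShaProofs`).
* `divisibleElements_divisible_of_isTorsion`, `nonempty_quot_divisibleElements_primaryComponent_addEquiv`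
  (torsion abelian groups `M` with finite `q`-torsion for all primes `q`): `M_div` is a divisible
  subgroup (strong induction on the order of an element, splitting off one primary part by Bézout),
  and `(M/M_div)[p^∞] ≃+ M[p^∞]/M[p^∞]_div`.
* the arithmetic input for `A = Ш(E/K)[p^∞]` (`exists_pairing_primaryComponent_sha`) is the one of
  `exists_natCard_modN_primaryComponent_sha`: `A[p] ⊆ Ш[p]` is finite (Silverman X.4.2(b),
  `finite_sha_torsionBy_holds`), `Ш` is torsion (`isTorsion_sha`), so the left kernel of the
  restricted pairing consists of elements divisible in `Ш`, hence in every `p^k A`.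

## References

* T. Dokchitser, V. Dokchitser, *On the Birch–Swinnerton-Dyer quotients modulo squares*, Ann. of
  Math. 172 (2010) 567–596, Thm. 4.3 and Cor. 4.5 (proof, p. 18). [DokchitserDokchitserAnnals2010]
* J. W. S. Cassels, *Arithmetic on curves of genus 1. IV. Proof of the Hauptvermutung*, J. reine
  angew. Math. 211 (1962) 95–112.
* J. S. Milne, *Arithmetic Duality Theorems*, 2nd ed. (2006), I.6.13(a), I.6.26.
* J. H. Silverman, *The Arithmetic of Elliptic Curves*, 2nd ed., Thm. X.4.14 and Exercise 10.20.
-/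

noncomputable section

open scoped Classical
open scoped AddSubgroup
open Literature.GroupTheory.FiniteAbelian

namespace Literature.NumberTheory.EllipticCurves

universe u

section Primary

variable {A : Type*} [AddCommGroup A] (p : ℕ) [hp : Fact p.Prime]

/-- Two commuting annihilators: if `a • x = 0` and `b • x = 0` with `a`, `b` coprime naturals, then
`x = 0` (local copy of the private helper of `CasselsTateParity`). [folklore] -/
private theorem eq_zero_of_coprime_nsmul' {Q : Type*} [AddCommGroup Q] {x : Q} {a b : ℕ}
    (hab : a.Coprime b) (ha : a • x = 0) (hb : b • x = 0) : x = 0 := by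
  rw [← addOrderOf_dvd_iff_nsmul_eq_zero] at ha hb
  exact AddMonoid.addOrderOf_eq_one_iff.mp (Nat.eq_one_of_dvd_coprimes hab ha hb)

/-- In a `p`-primary abelian group multiplication by an integer `m` prime to `p` is invertible on
every element: `x = m • (u • x)` for some `u` (`u m ≡ 1 (mod p^{e+1})` where `p^e x = 0`).
[folklore] -/
theorem exists_nsmul_nsmul_eq_of_not_dvd (hA : ∀ a : A, ∃ n : ℕ, p ^ n • a = 0) {m : ℕ}
    (hm : ¬p ∣ m) (x : A) : ∃ u : ℕ, m • (u • x) = x := by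
  obtain ⟨e, he⟩ := hA x
  have hcop : Nat.Coprime m (p ^ (e + 1)) :=
    Nat.Coprime.pow_right _ ((Nat.Prime.coprime_iff_not_dvd hp.out).mpr hm).symm
  have h1 : 1 < p ^ (e + 1) := Nat.one_lt_pow (Nat.succ_ne_zero e) hp.out.one_lt
  obtain ⟨u, -, hu⟩ := Nat.exists_mul_mod_eq_one_of_coprime hcop h1
  refine ⟨u, ?_⟩
  have he' : p ^ (e + 1) • x = 0 := by rw [pow_succ, mul_comm, ← smul_smul, he, smul_zero]
  rw [smul_smul, ← Nat.div_add_mod (m * u) (p ^ (e + 1)), hu, add_smul, one_smul, mul_comm,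
    ← smul_smul, he', smul_zero, zero_add]

/-- **The divisible part of a `p`-primary group with finite `p`-torsion.** If `A` is `p`-primary and
the chain `A[p] ∩ p^k A` is stable from `k₀` on (`exists_torsionBy_inf_range_stable`), then
`C = p^{k₀} A` is a divisible subgroup (every element of `C` is an `n`-th multiple of an element of
`C`, for every `n ≥ 1`) and `C` is exactly the subgroup of divisible elements of `A`. [folklore] -/
theorem range_nsmul_pow_eq_divisibleElements_of_stable (hA : ∀ a : A, ∃ n : ℕ, p ^ n • a = 0)
    {k₀ : ℕ}
    (hst : ∀ k, k₀ ≤ k → A[(p : ℤ)] ⊓ (nsmulAddMonoidHom (α := A) (p ^ k)).range =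
      A[(p : ℤ)] ⊓ (nsmulAddMonoidHom (α := A) (p ^ k₀)).range) :
    (∀ c ∈ (nsmulAddMonoidHom (α := A) (p ^ k₀)).range, ∀ n : ℕ, 0 < n →
        ∃ c' ∈ (nsmulAddMonoidHom (α := A) (p ^ k₀)).range, n • c' = c) ∧
      (nsmulAddMonoidHom (α := A) (p ^ k₀)).range = AddSubgroup.divisibleElements A := by
  set C : AddSubgroup A := (nsmulAddMonoidHom (α := A) (p ^ k₀)).range with hC
  -- `C` is `p`-divisible, hence `p^j`-divisible
  have hdiv : ∀ c ∈ C, ∃ c' ∈ C, p • c' = c := fun c hc ↦ by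
    obtain ⟨n, hn⟩ := hA c
    exact exists_nsmul_eq_of_stable p hst n c hc hn
  have hdiv' : ∀ (j : ℕ), ∀ c ∈ C, ∃ c' ∈ C, p ^ j • c' = c := by
    intro j
    induction j with
    | zero => exact fun c hc ↦ ⟨c, hc, by rw [pow_zero, one_smul]⟩
    | succ j ih =>
      intro c hc
      obtain ⟨c₁, hc₁, rfl⟩ := ih c hc
      obtain ⟨c₂, hc₂, rfl⟩ := hdiv c₁ hc₁
      exact ⟨c₂, hc₂, by rw [pow_succ, ← smul_smul]⟩
  -- hence divisible by every `n = p^v m`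
  have hdivall : ∀ c ∈ C, ∀ n : ℕ, 0 < n → ∃ c' ∈ C, n • c' = c := by
    intro c hc n hn
    obtain ⟨v, m, hm, rfl⟩ := Nat.exists_eq_pow_mul_and_not_dvd hn.ne' p hp.out.ne_one
    obtain ⟨c₁, hc₁, rfl⟩ := hdiv' v c hc
    obtain ⟨u, hu⟩ := exists_nsmul_nsmul_eq_of_not_dvd p hA hm c₁
    exact ⟨u • c₁, C.nsmul_mem hc₁ u, by rw [← smul_smul, hu]⟩
  refine ⟨hdivall, le_antisymm ?_ ?_⟩
  · intro c hc n hn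
    obtain ⟨c', -, hc'⟩ := hdivall c hc n hn
    exact ⟨c', hc'⟩
  · intro x hx
    obtain ⟨y, hy⟩ := (AddSubgroup.mem_divisibleElements_iff A x).mp hx (p ^ k₀) (pow_pos hp.out.pos _)
    exact ⟨y, by rw [nsmulAddMonoidHom_apply, hy]⟩

/-- **Core: `A / A_div` is finite of square order.** Let `A` be a `p`-primary abelian group with
finite `p`-torsion, carrying a bi-additive alternating pairing `B : A × A → ℚ/ℤ` whose left kernel
consists of `p^∞`-divisible elements (`hker`: `B(a, ·) = 0 ⇒ a ∈ p^k A` for all `k`). Then the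
subgroup `A_div` of divisible elements is a divisible subgroup, `A / A_div` is finite, and
`#(A / A_div)` is a square: with `k₀` as in `exists_torsionBy_inf_range_stable`, `A_div = p^{k₀} A`
(`range_nsmul_pow_eq_divisibleElements_of_stable`), `B` descends to a nondegenerate alternating
pairing on the finite group `A / p^{k₀} A` (as in `exists_natCard_modN_eq_pow_two_mul_of_pairing`),
and a finite abelian group with such a pairing into `ℚ/ℤ` has square order (Silverman, *AEC*,
Exercise 10.20: `isSquare_natCard_of_alternating_addCircle`). Classically `A ≅ (ℚ_p/ℤ_p)^ρ ⊕ M ⊕ M`.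
[folklore] -/
theorem finite_quot_and_isSquare_natCard_of_pairing (hA : ∀ a : A, ∃ n : ℕ, p ^ n • a = 0)
    [Finite A[(p : ℤ)]] (B : A →+ A →+ AddCircle (1 : ℚ)) (halt : ∀ a, B a a = 0)
    (hker : ∀ a, (∀ b, B a b = 0) → ∀ k : ℕ, a ∈ (nsmulAddMonoidHom (α := A) (p ^ k)).range) :
    (∀ d ∈ AddSubgroup.divisibleElements A, ∀ n : ℕ, 0 < n →
        ∃ d' ∈ AddSubgroup.divisibleElements A, n • d' = d) ∧
      Finite (A ⧸ AddSubgroup.divisibleElements A) ∧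
        IsSquare (Nat.card (A ⧸ AddSubgroup.divisibleElements A)) := by
  obtain ⟨k₀, hst⟩ := exists_torsionBy_inf_range_stable (A := A) p
  obtain ⟨hdivall, hCeq⟩ := range_nsmul_pow_eq_divisibleElements_of_stable p hA hst
  set C : AddSubgroup A := (nsmulAddMonoidHom (α := A) (p ^ k₀)).range with hC
  have hdiv : ∀ c ∈ C, ∃ c' ∈ C, p • c' = c := fun c hc ↦ by
    obtain ⟨c', hc', h⟩ := hdivall c hc p hp.out.pos
    exact ⟨c', hc', h⟩
  -- `B` vanishes on `C × A` and `A × C`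
  have hC₁ : ∀ c ∈ C, ∀ b, B c b = 0 := by
    intro c hc b
    obtain ⟨n, hn⟩ := hA b
    obtain ⟨c', -, rfl⟩ := hdivall c hc (p ^ n) (pow_pos hp.out.pos n)
    rw [map_nsmul, AddMonoidHom.nsmul_apply, ← map_nsmul, hn, map_zero]
  have hC₂ : ∀ a, ∀ c ∈ C, B a c = 0 := fun a c hc ↦ by
    rw [eq_neg_of_alternating B halt, hC₁ c hc a, neg_zero]
  -- the quotient `T = A / C` and its pairing
  obtain ⟨B', hB'⟩ := exists_quotient_pairing C B hC₁ hC₂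
  have hB'alt : ∀ z, B' z z = 0 := by
    intro z
    induction z using QuotientAddGroup.induction_on with
    | H a => rw [hB', halt]
  have hB'nd : ∀ z, (∀ w, B' z w = 0) → z = 0 := by
    intro z hz
    induction z using QuotientAddGroup.induction_on with
    | H a =>
      rw [QuotientAddGroup.eq_zero_iff, hC]
      exact hker a (fun b ↦ by rw [← hB', hz]) k₀
  -- `T[p]` is the image of `A[p]`
  haveI : Finite (A ⧸ C)[(p : ℤ)] := by
    refine Finite.of_surjective (fun x : A[(p : ℤ)] ↦ (⟨QuotientAddGroup.mk (x : A), ?_⟩ :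
      (A ⧸ C)[(p : ℤ)])) ?_
    · rw [AddSubgroup.torsionBy.nsmul_iff, ← QuotientAddGroup.mk_nsmul,
        AddSubgroup.torsionBy.nsmul_iff.mp x.2, QuotientAddGroup.mk_zero]
    · rintro ⟨z, hz⟩
      induction z using QuotientAddGroup.induction_on with
      | H a =>
        rw [AddSubgroup.torsionBy.nsmul_iff, ← QuotientAddGroup.mk_nsmul,
          QuotientAddGroup.eq_zero_iff] at hz
        obtain ⟨c, hc, hca⟩ := hdiv _ hz
        refine ⟨⟨a - c, ?_⟩, Subtype.ext ?_⟩
        · rw [AddSubgroup.torsionBy.nsmul_iff, smul_sub, hca, sub_self]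
        · change (QuotientAddGroup.mk (a - c) : A ⧸ C) = QuotientAddGroup.mk a
          rw [QuotientAddGroup.mk_sub, (QuotientAddGroup.eq_zero_iff c).mpr hc, sub_zero]
  -- `p^k₀ T = 0`, so `T` is finite
  haveI hfinT : Finite (A ⧸ C) := by
    haveI := finite_torsionBy_pow (A ⧸ C) p k₀
    refine Finite.of_injective (fun z : A ⧸ C ↦ (⟨z, ?_⟩ : (A ⧸ C)[((p ^ k₀ : ℕ) : ℤ)]))
      (fun z w h ↦ congrArg Subtype.val h)
    induction z using QuotientAddGroup.induction_on with
    | H a =>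
      rw [AddSubgroup.torsionBy.nsmul_iff, ← QuotientAddGroup.mk_nsmul, QuotientAddGroup.eq_zero_iff]
      exact ⟨a, rfl⟩
  -- square order of `T`, transported along `C = A_div`
  have hsqT : IsSquare (Nat.card (A ⧸ C)) :=
    isSquare_natCard_of_alternating_addCircle (A ⧸ C) B' hB'alt hB'nd
  have e : A ⧸ C ≃+ A ⧸ AddSubgroup.divisibleElements A :=
    QuotientAddGroup.quotientAddEquivOfEq hCeq
  refine ⟨fun d hd n hn ↦ ?_, Finite.of_equiv _ e.toEquiv, ?_⟩
  · rw [← hCeq] at hd ⊢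
    exact hdivall d hd n hn
  · rwa [← Nat.card_congr e.toEquiv]

end Primary

/-! ### Torsion groups with finite `q`-torsion for every prime `q`: the divisible part -/

section Torsion

variable {M : Type*} [AddCommGroup M]

/-- The `p`-primary component of `M` is a `p`-primary group. [folklore] -/
theorem primaryComponent_isPrimary (p : ℕ) [Fact p.Prime] :
    ∀ a : AddCommGroup.primaryComponent M p, ∃ n : ℕ, p ^ n • a = 0 := fun a ↦ by
  obtain ⟨n, hn⟩ := (AddCommGroup.mem_primaryComponent).mp a.2
  exact ⟨n, Subtype.ext hn⟩

/-- The `p`-torsion of the `p`-primary component embeds in `M[p]`, so it is finite when `M[p]` is.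
[folklore] -/
theorem finite_torsionBy_primaryComponent (p : ℕ) [Fact p.Prime] [Finite M[(p : ℤ)]] :
    Finite (↥(AddCommGroup.primaryComponent M p))[(p : ℤ)] :=
  Finite.of_injective
    (fun x ↦ (⟨((x : AddCommGroup.primaryComponent M p) : M), AddSubgroup.torsionBy.nsmul_iff.mpr (by
        rw [← AddSubgroupClass.coe_nsmul, ← AddSubgroupClass.coe_nsmul, AddSubgroup.torsionBy.nsmul x,
          ZeroMemClass.coe_zero, ZeroMemClass.coe_zero])⟩ : M[(p : ℤ)]))
    (fun x y hxy ↦ Subtype.ext (Subtype.ext (congrArg (fun z : M[(p : ℤ)] ↦ (z : M)) hxy)))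

/-- **An element of the `p`-primary component which is divisible in `M` is divisible inside the
`p`-primary component**: a `p^v`-th root of a `p`-power-torsion element is `p`-power torsion, and
division by `m` prime to `p` is free in a `p`-primary group (`exists_nsmul_nsmul_eq_of_not_dvd`).
[folklore] -/
theorem mem_divisibleElements_primaryComponent_of_mem (p : ℕ) [hp : Fact p.Prime] {x : M}
    (hx : x ∈ AddCommGroup.primaryComponent M p) (hdx : x ∈ AddSubgroup.divisibleElements M) :
    (⟨x, hx⟩ : AddCommGroup.primaryComponent M p) ∈
      AddSubgroup.divisibleElements (AddCommGroup.primaryComponent M p) := by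
  rw [AddSubgroup.mem_divisibleElements_iff]
  intro n hn
  obtain ⟨v, m, hm, rfl⟩ := Nat.exists_eq_pow_mul_and_not_dvd hn.ne' p hp.out.ne_one
  obtain ⟨e, he⟩ := (AddCommGroup.mem_primaryComponent).mp hx
  obtain ⟨y, hy⟩ := (AddSubgroup.mem_divisibleElements_iff M x).mp hdx (p ^ v) (pow_pos hp.out.pos v)
  have hyA : y ∈ AddCommGroup.primaryComponent M p := by
    rw [AddCommGroup.mem_primaryComponent]
    exact ⟨v + e, by rw [pow_add, mul_comm, ← smul_smul, hy, he]⟩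
  obtain ⟨u, hu⟩ := exists_nsmul_nsmul_eq_of_not_dvd p (primaryComponent_isPrimary (M := M) p) hm
    ⟨y, hyA⟩
  refine ⟨u • ⟨y, hyA⟩, ?_⟩
  rw [← smul_smul, hu]
  exact Subtype.ext hy

/-- **The divisible elements of the `p`-primary component form a divisible subgroup** when `M[p]` is
finite: `A_div = p^{k₀} A` for the stable index `k₀` of the chain `A[p] ∩ p^k A`
(`range_nsmul_pow_eq_divisibleElements_of_stable`). [folklore] -/
theorem divisibleElements_primaryComponent_divisible (p : ℕ) [hp : Fact p.Prime] [Finite M[(p : ℤ)]] :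
    ∀ d ∈ AddSubgroup.divisibleElements (AddCommGroup.primaryComponent M p), ∀ n : ℕ, 0 < n →
      ∃ d' ∈ AddSubgroup.divisibleElements (AddCommGroup.primaryComponent M p), n • d' = d := by
  haveI := finite_torsionBy_primaryComponent (M := M) p
  obtain ⟨k₀, hst⟩ := exists_torsionBy_inf_range_stable (A := AddCommGroup.primaryComponent M p) p
  obtain ⟨hdivall, hCeq⟩ :=
    range_nsmul_pow_eq_divisibleElements_of_stable p (primaryComponent_isPrimary (M := M) p) hst
  rw [← hCeq]
  exact hdivall

/-- One step of the primary decomposition of a torsion element: if `x` has order `q^v m` with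
`q ∤ m`, then `x = x₁ + x₂` with `q^v x₁ = 0`, `m x₂ = 0`, both integer multiples of `x` (Bézout).
[folklore] -/
theorem exists_add_eq_of_addOrderOf_eq {x : M} {q v m : ℕ} (hq : q.Prime) (hm : ¬q ∣ m)
    (hx : addOrderOf x = q ^ v * m) :
    ∃ s t : ℤ, (t * m) • x + (s * (q ^ v : ℕ)) • x = x ∧
      q ^ v • ((t * m) • x) = 0 ∧ m • ((s * (q ^ v : ℕ)) • x) = 0 := by
  have hcop : IsCoprime ((q ^ v : ℕ) : ℤ) (m : ℤ) :=
    Nat.isCoprime_iff_coprime.mpr (Nat.Coprime.pow_left v ((Nat.Prime.coprime_iff_not_dvd hq).mpr hm))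
  obtain ⟨s, t, hst⟩ := hcop
  have hN : (q ^ v * m) • x = 0 := by rw [← hx]; exact addOrderOf_nsmul_eq_zero x
  refine ⟨s, t, ?_, ?_, ?_⟩
  · rw [← add_smul, add_comm, hst, one_smul]
  · have h : ((t * m : ℤ)) • x = t • (m • x) := by rw [mul_smul, natCast_zsmul]
    rw [h, smul_comm, smul_smul, hN, smul_zero]
  · have h : ((s * (q ^ v : ℕ) : ℤ)) • x = s • (q ^ v • x) := by rw [mul_smul, natCast_zsmul]
    rw [h, smul_comm, smul_smul, mul_comm m, hN, smul_zero]

/-- **The divisible elements of a torsion abelian group with finite `q`-torsion for every prime `q`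
form a divisible subgroup**: every divisible `d` is `n • d'` with `d'` divisible, for every `n ≥ 1`.
Proof by strong induction on the order of `d`: split `d = d₁ + d₂` with `d₁` in the `q`-primary
component (`q` a prime factor of the order) and `d₂` of smaller order
(`exists_add_eq_of_addOrderOf_eq`); `d₁` is divisible inside the `q`-primary component
(`mem_divisibleElements_primaryComponent_of_mem`), where the divisible elements form a divisible
subgroup (`divisibleElements_primaryComponent_divisible`). So for such groups (e.g. `Ш(E/K)`) the
subgroup of divisible elements is the maximal divisible subgroup `M_div`
(Milne, *ADT*, Ch. 0, Notations). [folklore] -/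
theorem divisibleElements_divisible_of_isTorsion (hM : AddMonoid.IsTorsion M)
    (hfin : ∀ q : ℕ, q.Prime → Finite M[(q : ℤ)]) :
    ∀ d ∈ AddSubgroup.divisibleElements M, ∀ n : ℕ, 0 < n →
      ∃ d' ∈ AddSubgroup.divisibleElements M, n • d' = d := by
  intro d hd n hn
  -- strong induction on the order of `d`
  suffices h : ∀ (N : ℕ) (d : M), addOrderOf d = N → d ∈ AddSubgroup.divisibleElements M →
      ∃ d' ∈ AddSubgroup.divisibleElements M, n • d' = d from h _ d rfl hd
  intro N
  induction N using Nat.strong_induction_on with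
  | _ N ih =>
    intro d hdN hd
    by_cases hd0 : d = 0
    · exact ⟨0, zero_mem _, by rw [hd0, smul_zero]⟩
    have hNpos : 0 < N := hdN ▸ (hM d).addOrderOf_pos
    have hN1 : N ≠ 1 := fun h ↦ hd0 (AddMonoid.addOrderOf_eq_one_iff.mp (hdN.trans h))
    -- a prime factor `q` of `N`, `N = q^v m`, `q ∤ m`, `v ≥ 1`
    set q := N.minFac with hq
    have hqprime : q.Prime := Nat.minFac_prime hN1
    obtain ⟨v, m, hm, hNvm⟩ := Nat.exists_eq_pow_mul_and_not_dvd hNpos.ne' q hqprime.ne_one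
    have hv : v ≠ 0 := by
      rintro rfl
      rw [pow_zero, one_mul] at hNvm
      exact hm (hNvm ▸ Nat.minFac_dvd N)
    have hm0 : 0 < m := Nat.pos_of_ne_zero (by rintro rfl; rw [mul_zero] at hNvm; omega)
    have hmN : m < N := by
      rw [hNvm]
      exact lt_mul_left hm0 (Nat.one_lt_pow hv hqprime.one_lt)
    haveI : Fact q.Prime := ⟨hqprime⟩
    haveI := hfin q hqprime
    obtain ⟨s, t, hsum, h1, h2⟩ := exists_add_eq_of_addOrderOf_eq hqprime hm (hdN.trans hNvm)
    -- `d₁ = (t m) • d` : `q`-primary and divisible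
    have hd₁A : (t * m : ℤ) • d ∈ AddCommGroup.primaryComponent M q :=
      (AddCommGroup.mem_primaryComponent).mpr ⟨v, h1⟩
    have hd₁D : (t * m : ℤ) • d ∈ AddSubgroup.divisibleElements M := AddSubgroup.zsmul_mem _ hd _
    obtain ⟨d₁', hd₁', hd₁'eq⟩ := divisibleElements_primaryComponent_divisible (M := M) q _
      (mem_divisibleElements_primaryComponent_of_mem q hd₁A hd₁D) n hn
    -- `d₂ = (s q^v) • d` : of order `≤ m < N`, divisible
    have hd₂D : (s * (q ^ v : ℕ) : ℤ) • d ∈ AddSubgroup.divisibleElements M :=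
      AddSubgroup.zsmul_mem _ hd _
    have hd₂ord : addOrderOf ((s * (q ^ v : ℕ) : ℤ) • d) < N := by
      exact lt_of_le_of_lt (Nat.le_of_dvd hm0 (addOrderOf_dvd_of_nsmul_eq_zero h2)) hmN
    obtain ⟨d₂', hd₂', hd₂'eq⟩ := ih _ hd₂ord _ rfl hd₂D
    refine ⟨(d₁' : M) + d₂', add_mem ?_ hd₂', ?_⟩
    · -- divisible elements of a subgroup are divisible in `M`
      rw [AddSubgroup.mem_divisibleElements_iff]
      intro k hk
      obtain ⟨y, hy⟩ := (AddSubgroup.mem_divisibleElements_iff _ _).mp hd₁' k hk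
      exact ⟨y, by rw [← AddSubgroupClass.coe_nsmul, hy]⟩
    · have h1' : n • (d₁' : M) = (t * m : ℤ) • d := by rw [← AddSubgroupClass.coe_nsmul, hd₁'eq]
      rw [smul_add, h1', hd₂'eq, hsum]

/-- **`(M / M_div)[p^∞] ≅ M[p^∞] / M[p^∞]_div`** for a torsion abelian group `M` with finite
`q`-torsion for every prime `q`: the map `M[p^∞] → M / M_div` has kernel `M[p^∞] ∩ M_div = M[p^∞]_div`
(`mem_divisibleElements_primaryComponent_of_mem`) and image the `p`-primary component of `M / M_div`
(`M_div` being a divisible subgroup, `divisibleElements_divisible_of_isTorsion`, a class killed by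
`p^k` lifts to an element killed by `p^k`). [folklore] -/
theorem nonempty_quot_divisibleElements_primaryComponent_addEquiv (hM : AddMonoid.IsTorsion M)
    (hfin : ∀ q : ℕ, q.Prime → Finite M[(q : ℤ)]) (p : ℕ) [hp : Fact p.Prime] :
    Nonempty ((AddCommGroup.primaryComponent M p ⧸
        AddSubgroup.divisibleElements (AddCommGroup.primaryComponent M p)) ≃+
      AddCommGroup.primaryComponent (M ⧸ AddSubgroup.divisibleElements M) p) := by
  set D := AddSubgroup.divisibleElements M with hD
  set A := AddCommGroup.primaryComponent M p with hA
  let φ : A →+ M ⧸ D := (QuotientAddGroup.mk' D).comp A.subtype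
  have hφ : ∀ a : A, φ a = QuotientAddGroup.mk (a : M) := fun _ ↦ rfl
  -- kernel
  have hker : φ.ker = AddSubgroup.divisibleElements A := by
    ext a
    rw [AddMonoidHom.mem_ker, hφ, QuotientAddGroup.eq_zero_iff]
    constructor
    · intro ha
      have := mem_divisibleElements_primaryComponent_of_mem p a.2 ha
      simpa using this
    · intro ha
      rw [AddSubgroup.mem_divisibleElements_iff]
      intro k hk
      obtain ⟨y, hy⟩ := (AddSubgroup.mem_divisibleElements_iff _ _).mp ha k hk
      exact ⟨y, by rw [← AddSubgroupClass.coe_nsmul, hy]⟩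
  -- range
  have hrange : φ.range = AddCommGroup.primaryComponent (M ⧸ D) p := by
    apply le_antisymm
    · rintro _ ⟨a, rfl⟩
      obtain ⟨e, he⟩ := primaryComponent_isPrimary (M := M) p a
      exact (AddCommGroup.mem_primaryComponent).mpr ⟨e, by rw [← map_nsmul, he, map_zero]⟩
    · intro z hz
      obtain ⟨k, hk⟩ := (AddCommGroup.mem_primaryComponent).mp hz
      induction z using QuotientAddGroup.induction_on with
      | H x =>
        rw [← QuotientAddGroup.mk_nsmul, QuotientAddGroup.eq_zero_iff] at hk
        obtain ⟨d, hd, hdx⟩ :=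
          divisibleElements_divisible_of_isTorsion hM hfin _ hk (p ^ k) (pow_pos hp.out.pos k)
        have hxd : x - d ∈ A :=
          (AddCommGroup.mem_primaryComponent).mpr ⟨k, by rw [smul_sub, hdx, sub_self]⟩
        refine ⟨⟨x - d, hxd⟩, ?_⟩
        rw [hφ, AddSubgroup.coe_mk, QuotientAddGroup.mk_sub, (QuotientAddGroup.eq_zero_iff d).mpr hd,
          sub_zero]
  exact ⟨((QuotientAddGroup.quotientAddEquivOfEq hker).symm.trans
    (QuotientAddGroup.quotientKerEquivRange φ)).trans (AddEquiv.addSubgroupCongr hrange)⟩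

end Torsion

/-! ### `Ш(E/K)[p^∞]` modulo its divisible part -/

section Sha

open WeierstrassCurve

variable {K : Type u} [Field K] [NumberField K] (W : WeierstrassCurve K) [W.IsElliptic]
  (p : ℕ) [hp : Fact p.Prime]

/-- **The arithmetic input, packaged.** Granting the Cassels–Tate pairing on `Ш(E/K)` (`hCT`), the
`p`-primary part `A = Ш(E/K)[p^∞]` is `p`-primary with finite `p`-torsion (`finite_sha_torsionBy_holds`,
Silverman X.4.2(b)) and carries the restricted alternating pairing `A × A → ℚ/ℤ` whose left kernel
lies in every `p^k A`: an element of `A` orthogonal to `A` is orthogonal to all of `Ш` (`Ш` is torsion,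
`isTorsion_sha`, coprime-order argument), hence divisible in `Ш` by the kernel clause of the fact,
and a `p^k`-th root in `Ш` of an element of `A` lies in `A`. (Same argument as
`exists_natCard_modN_primaryComponent_sha`.) [folklore] -/
theorem exists_pairing_primaryComponent_sha (hCT : exists_casselsTate_pairing (K := K)) :
    (∀ a : AddCommGroup.primaryComponent W.sha p, ∃ n : ℕ, p ^ n • a = 0) ∧
      Finite (↥(AddCommGroup.primaryComponent W.sha p))[(p : ℤ)] ∧
      ∃ BA : AddCommGroup.primaryComponent W.sha p →+ AddCommGroup.primaryComponent W.sha p →+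
          AddCircle (1 : ℚ),
        (∀ a, BA a a = 0) ∧
          ∀ a, (∀ b, BA a b = 0) → ∀ k : ℕ,
            a ∈ (nsmulAddMonoidHom (α := AddCommGroup.primaryComponent W.sha p) (p ^ k)).range := by
  obtain ⟨B, halt, hkerB⟩ := hCT W
  set A : AddSubgroup W.sha := AddCommGroup.primaryComponent W.sha p with hAdef
  -- `A` is `p`-primary with finite `p`-torsion
  have hA : ∀ a : A, ∃ n : ℕ, p ^ n • a = 0 := fun a ↦ by
    obtain ⟨n, hn⟩ := (AddCommGroup.mem_primaryComponent).mp a.2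
    exact ⟨n, Subtype.ext hn⟩
  haveI : Finite (AddSubgroup.torsionBy W.sha (p : ℤ)) :=
    W.finite_sha_torsionBy_holds p (Int.natCast_ne_zero.mpr hp.out.ne_zero)
  haveI hfin : Finite (↥A)[(p : ℤ)] :=
    Finite.of_injective
      (fun x ↦ (⟨((x : A) : W.sha), AddSubgroup.torsionBy.nsmul_iff.mpr (by
          rw [← AddSubgroupClass.coe_nsmul, ← AddSubgroupClass.coe_nsmul, AddSubgroup.torsionBy.nsmul x,
            ZeroMemClass.coe_zero, ZeroMemClass.coe_zero])⟩ :
          AddSubgroup.torsionBy W.sha p))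
      (fun x y hxy ↦ Subtype.ext (Subtype.ext (congrArg (fun z : AddSubgroup.torsionBy W.sha p ↦
        (z : W.sha)) hxy)))
  -- the pairing restricted to `A`
  let BA : A →+ A →+ AddCircle (1 : ℚ) := (AddMonoidHom.compHom' A.subtype).comp (B.comp A.subtype)
  have hBA : ∀ a b : A, BA a b = B a b := fun _ _ ↦ rfl
  have hBAalt : ∀ a : A, BA a a = 0 := fun a ↦ by rw [hBA, halt]
  -- its kernel is `p^∞`-divisible
  have hker : ∀ a : A, (∀ b : A, BA a b = 0) →
      ∀ k : ℕ, a ∈ (nsmulAddMonoidHom (α := A) (p ^ k)).range := by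
    intro a ha k
    obtain ⟨e, he⟩ := hA a
    -- `a` is orthogonal to all of `Ш`
    have hall : ∀ z : W.sha, B a z = 0 := by
      intro z
      have hz := W.isTorsion_sha z
      set n := addOrderOf z with hn
      have hn0 : n ≠ 0 := (hz.addOrderOf_pos).ne'
      obtain ⟨v, m, hm, hnm⟩ := Nat.exists_eq_pow_mul_and_not_dvd hn0 p hp.out.ne_one
      -- `m • z ∈ A`
      have hmz : m • z ∈ A := by
        rw [hAdef, AddCommGroup.mem_primaryComponent]
        refine ⟨v, ?_⟩
        rw [smul_smul, ← hnm, hn, addOrderOf_nsmul_eq_zero]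
      have h1 : m • B a z = 0 := by
        rw [← map_nsmul]
        have h := ha ⟨m • z, hmz⟩
        rwa [hBA] at h
      have h2 : p ^ e • B a z = 0 := by
        rw [← AddMonoidHom.nsmul_apply, ← map_nsmul]
        have : (p ^ e • a : A) = 0 := he
        rw [← AddSubgroupClass.coe_nsmul, this, ZeroMemClass.coe_zero, map_zero, AddMonoidHom.zero_apply]
      exact eq_zero_of_coprime_nsmul'
        (Nat.Coprime.pow_left e ((Nat.Prime.coprime_iff_not_dvd hp.out).mpr hm)) h2 h1
    -- hence divisible in `Ш`, hence in `p^k A`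
    have hdivz : ((a : A) : W.sha) ∈ AddSubgroup.divisibleElements W.sha := (hkerB _).mp hall
    obtain ⟨y, hy⟩ := (AddSubgroup.mem_divisibleElements_iff _ _).mp hdivz (p ^ k) (pow_pos hp.out.pos k)
    have hyA : y ∈ A := by
      rw [hAdef, AddCommGroup.mem_primaryComponent]
      refine ⟨k + e, ?_⟩
      rw [pow_add, mul_comm, ← smul_smul, hy, ← AddSubgroupClass.coe_nsmul]
      have : (p ^ e • a : A) = 0 := he
      rw [this, ZeroMemClass.coe_zero]
    exact ⟨⟨y, hyA⟩, Subtype.ext (by rw [nsmulAddMonoidHom_apply, AddSubgroupClass.coe_nsmul]; exact hy)⟩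
  exact ⟨hA, hfin, BA, hBAalt, hker⟩

/-- **The divisible elements of `Ш(E/K)[p^∞]` form a divisible subgroup** (only the finiteness of
`Ш[p]`, Silverman X.4.2(b), is used): every divisible element is an `n`-th multiple of a divisible
element, for every `n ≥ 1`. So for `A = Ш(E/K)[p^∞]` the subgroup `AddSubgroup.divisibleElements A`
is the maximal divisible subgroup `A_div` (Milne, *ADT*, Ch. 0, Notations). [folklore] -/
theorem divisibleElements_primaryComponent_sha_divisible :
    ∀ d ∈ AddSubgroup.divisibleElements (AddCommGroup.primaryComponent W.sha p), ∀ n : ℕ, 0 < n →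
      ∃ d' ∈ AddSubgroup.divisibleElements (AddCommGroup.primaryComponent W.sha p), n • d' = d := by
  haveI : Finite (AddSubgroup.torsionBy W.sha (p : ℤ)) :=
    W.finite_sha_torsionBy_holds p (Int.natCast_ne_zero.mpr hp.out.ne_zero)
  exact divisibleElements_primaryComponent_divisible (M := W.sha) p

omit hp in
/-- **`Ш(E/K)_div`, the subgroup of divisible elements of `Ш(E/K)`, is a divisible subgroup** (hence
the maximal divisible subgroup, "the divisible part of `Ш`" of Dokchitser–Dokchitser 2010, Def. 4.1 /
Thm. 4.3): `Ш` is torsion (`isTorsion_sha`) with finite `q`-torsion for every prime `q`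
(`finite_sha_torsionBy_holds`), and `divisibleElements_divisible_of_isTorsion` applies. [folklore] -/
theorem divisibleElements_sha_divisible :
    ∀ d ∈ AddSubgroup.divisibleElements W.sha, ∀ n : ℕ, 0 < n →
      ∃ d' ∈ AddSubgroup.divisibleElements W.sha, n • d' = d :=
  divisibleElements_divisible_of_isTorsion W.isTorsion_sha
    (fun q hq ↦ W.finite_sha_torsionBy_holds q (Int.natCast_ne_zero.mpr hq.ne_zero))

/-- **`Ш(E/K)[p^∞]` modulo its divisible part is finite** (granting the Cassels–Tate pairing).
Dokchitser–Dokchitser 2010, Thm. 4.3 / Cor. 4.5 use `|X₀(X)[p^∞]|`, `X₀ = Ш` modulo its divisible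
part, as a (finite) number. [cite: DokchitserDokchitserAnnals2010, Thm. 4.3 and Cor. 4.5 (p. 18)] -/
theorem finite_quot_divisibleElements_primaryComponent_sha (hCT : exists_casselsTate_pairing (K := K)) :
    Finite (AddCommGroup.primaryComponent W.sha p ⧸
      AddSubgroup.divisibleElements (AddCommGroup.primaryComponent W.sha p)) := by
  obtain ⟨hA, hfin, BA, halt, hker⟩ := exists_pairing_primaryComponent_sha W p hCT
  exact (finite_quot_and_isSquare_natCard_of_pairing p hA BA halt hker).2.1

/-- **Dokchitser–Dokchitser 2010, proof of Cor. 4.5: "the `p`-primary parts of `Ш/Ш_div` have square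
order by Cassels–Tate pairing"**, for an elliptic curve over a number field: granting the
Cassels–Tate pairing (`hCT`), `#(Ш(E/K)[p^∞] / Ш(E/K)[p^∞]_div)` is a perfect square.
[cite: DokchitserDokchitserAnnals2010, Cor. 4.5 (proof, p. 18)] [cite: SilvermanAEC2009, Thm. X.4.14] -/
theorem isSquare_natCard_quot_divisibleElements_primaryComponent_sha
    (hCT : exists_casselsTate_pairing (K := K)) :
    IsSquare (Nat.card (AddCommGroup.primaryComponent W.sha p ⧸
      AddSubgroup.divisibleElements (AddCommGroup.primaryComponent W.sha p))) := by
  obtain ⟨hA, hfin, BA, halt, hker⟩ := exists_pairing_primaryComponent_sha W p hCT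
  exact (finite_quot_and_isSquare_natCard_of_pairing p hA BA halt hker).2.2

/-- **`X₀(E/K)[p^∞] ≅ Ш[p^∞] / Ш[p^∞]_div`**, where `X₀(E/K) = Ш(E/K) / Ш(E/K)_div` is "`Ш` modulo its
divisible part" (Dokchitser–Dokchitser 2010, Thm. 4.3): the `p`-primary component of the quotient is
the quotient of the `p`-primary component. [folklore] -/
theorem nonempty_primaryComponent_sha_quot_divisibleElements_addEquiv :
    Nonempty ((AddCommGroup.primaryComponent W.sha p ⧸
        AddSubgroup.divisibleElements (AddCommGroup.primaryComponent W.sha p)) ≃+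
      AddCommGroup.primaryComponent (W.sha ⧸ AddSubgroup.divisibleElements W.sha) p) :=
  nonempty_quot_divisibleElements_primaryComponent_addEquiv W.isTorsion_sha
    (fun q hq ↦ W.finite_sha_torsionBy_holds q (Int.natCast_ne_zero.mpr hq.ne_zero)) p

/-- **`X₀(E/K)[p^∞]` is finite** (granting the Cassels–Tate pairing), `X₀ = Ш/Ш_div`: the form in which
Dokchitser–Dokchitser 2010, Thm. 4.3, use `|X₀(X)[p^∞]|`.
[cite: DokchitserDokchitserAnnals2010, Thm. 4.3 (p. 17)] -/
theorem finite_primaryComponent_sha_quot_divisibleElements (hCT : exists_casselsTate_pairing (K := K)) :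
    Finite (AddCommGroup.primaryComponent (W.sha ⧸ AddSubgroup.divisibleElements W.sha) p) := by
  obtain ⟨e⟩ := nonempty_primaryComponent_sha_quot_divisibleElements_addEquiv W p
  haveI := finite_quot_divisibleElements_primaryComponent_sha W p hCT
  exact Finite.of_equiv _ e.toEquiv

/-- **Dokchitser–Dokchitser 2010, proof of Cor. 4.5, verbatim form: "the `p`-primary parts of
`Ш/Ш_div` have square order by Cassels–Tate pairing"** — for an elliptic curve `E` over a number
field `K`, granting the Cassels–Tate pairing (`hCT`), `#(Ш(E/K)/Ш(E/K)_div)[p^∞]` is a perfect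
square. [cite: DokchitserDokchitserAnnals2010, Cor. 4.5 (proof, p. 18)]
[cite: SilvermanAEC2009, Thm. X.4.14] -/
theorem isSquare_natCard_primaryComponent_sha_quot_divisibleElements
    (hCT : exists_casselsTate_pairing (K := K)) :
    IsSquare (Nat.card (AddCommGroup.primaryComponent (W.sha ⧸ AddSubgroup.divisibleElements W.sha) p)) := by
  obtain ⟨e⟩ := nonempty_primaryComponent_sha_quot_divisibleElements_addEquiv W p
  rw [← Nat.card_congr e.toEquiv]
  exact isSquare_natCard_quot_divisibleElements_primaryComponent_sha W p hCT

end Sha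

end Literature.NumberTheory.EllipticCurves

end
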